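import Literature.AlgebraicGeometry.Motives.HodgeThetaSubalgebraUnitaryTenCore
import HarnessLib

/-!
# The `Θ`-subalgebra theorem for unitary multiplicities `(11, b)`, EVERY `b` prime to `11`, and `(9, b)`,
# `b ∈ {1, 2, 4, 5, 7, 11, 13}` — complex–Hermitian, classification-free (Ribet 1983 Thm. 3, Lie step; `23 = 11 + 12`)

Family `hodge`, layer `Literature/AlgebraicGeometry/Motives` (pure linear algebra over `ℂ`; no geometry). Research
context: cell `pub-hodge-ring2` (HONEST FRAMING: research route conditional on HC_CM; not a corollary; Q11.4-sentence-2
already refuted in dim ≥ 3), Literature lane gen 84, programme R69. UNCONDITIONAL; theorems only, no definition, no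
named fact (D-0026), no `sorry`.

WHY A PRIME `a = dim P` IS EASY. At a raising operator of maximal rank `r ≤ a − 2` the Ψ-core route
(`UnitaryRaisingRank.exists_raise_rank_gt_of_psi_core`) needs the Levi core of type `(a − r | r)`, a pair summing to the
prime `a`, hence coprime — and for `a = 11` all of `(9|2), (8|3), (7|4), (6|5), (5|6), (4|7), (3|8), (2|9)` are in the
tree; at the top rank `r = a − 1` the triple route (`…_of_finrank_eq_succ_of_smul`) needs no solution of
`m (a − ρ) = (a − 1) ρ`, `1 ≤ ρ ≤ a − 2`, `m = dim Q − r`: reducing mod `a` gives `ρ (m − 1) ≡ 0`, so `(a / gcd(a, ρ)) ∣ m − 1`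
and then `gcd(a, dim Q) > 1` — i.e. for coprime `(a, dim Q)` THE TOP RANK NEVER OBSTRUCTS (here checked by `omega` case
by case). The Euclid descent `b → b − 11` needs the bases `(11 | c)`, `c ≤ 10`, all in the tree after this file's §1
(`(9 | 11)`) and `HodgeThetaSubalgebraUnitaryTenCore` (`(10 | 11)`).

* §0 **`UnitaryLadder.exists_raise_onto_of_hup`** — the generic ladder: if every raising operator of rank `2 ≤ ρ < dim P`
  can be out-ranked, some raising operator maps onto `P` (replaces the hand-unrolled ladders of the earlier files).
* §1 **`UnitaryNine.exists_raise_onto_nine_of_smul`** (`dim Q ≥ 10` odd, `3 ∤ dim Q`), **`UnitaryNine.eq_top_of_smul`**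
  (`(9 | b)`, `b ∈ {1, 2, 4, 5, 7, 11, 13}`) and its mirror. HONEST SCOPE: `(9 | 8)`, `(9 | 10)` are stalls (rank `6`),
  so `(9 | 17)`, `(9 | 19)` are not reached; even `b` fail at rank `6`.
* §2 **`UnitaryEleven.exists_raise_onto_eleven_of_smul`** (`dim Q ≥ 12`, `11 ∤ dim Q`), **`UnitaryEleven.eq_top_of_smul`**
  — THE `(11 | b)` CORE FOR EVERY `b` WITH `11 ∤ b` — and its mirror.
* §3 **`UnitaryRaisingRank.exists_raise_rank_gt_of_finrank_eq_succ_of_coprime`** — the top rank `r = dim P − 1` is always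
  raised when `gcd(dim P, dim Q) = 1` (the number-theoretic remark above, as a theorem).

## References
* [Ribet1983] K. A. Ribet, *Hodge classes on certain types of abelian varieties*, Amer. J. Math. 105 (1983), Thm. 3
  (= [Gordon1997, Thm. 6.3 (3)], held `paper:arxiv-alg-geom_9709030` pp. 18–19).
* [Deligne1982HodgeCycles] P. Deligne, *Hodge cycles on abelian varieties*, LNM 900 (1982), I §3 Prop. 3.4, 3.6.
* [GoodmanWallachGTM255] R. Goodman, N. R. Wallach, GTM 255 (2009), §4.1.1, §3.3.2.
-/

noncomputable section

namespace Literature.AlgebraicGeometry.Motives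

namespace HodgeStructure

/-! ### §0 The generic ladder -/

section Ladder

universe u

variable {W : Type u} [AddCommGroup W] [Module ℂ W]

/-- **The generic raising ladder.** If `dim P = a ≥ 2`, `dim Q ≥ 2`, and every raising operator of rank `2 ≤ ρ ≤ a − 1`
is out-ranked by another raising operator of `𝔊`, then some raising operator of `𝔊` maps onto `P`.
[cite: Ribet1983, Thm. 3] [cite: Deligne1982HodgeCycles, I §3 Prop. 3.6] -/
theorem UnitaryLadder.exists_raise_onto_of_hup [FiniteDimensional ℂ W] {𝔊 : Submodule ℂ (Module.End ℂ W)}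
    (hbr : ∀ Y ∈ 𝔊, ∀ Z ∈ 𝔊, Y * Z - Z * Y ∈ 𝔊)
    (hirr : ∀ U : Submodule ℂ W, (∀ A ∈ 𝔊, ∀ u ∈ U, A u ∈ U) → U = ⊥ ∨ U = ⊤)
    {Θ : Module.End ℂ W} (hΘ : Θ ∈ 𝔊) (hΘΘ : Θ * Θ = 1)
    {P Q : Submodule ℂ W} (hP : ∀ x, x ∈ P ↔ Θ x = x) (hQ : ∀ x, x ∈ Q ↔ Θ x = -x)
    {a : ℕ} (hPa : Module.finrank ℂ P = a) (ha : 2 ≤ a) (hQ2 : 2 ≤ Module.finrank ℂ Q)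
    (hup : ∀ B' ∈ 𝔊, Θ * B' = B' → B' * Θ = -B' →
      2 ≤ Module.finrank ℂ (LinearMap.range B') → Module.finrank ℂ (LinearMap.range B') ≤ a - 1 →
      ∃ B'' ∈ 𝔊, Θ * B'' = B'' ∧ B'' * Θ = -B'' ∧
        Module.finrank ℂ (LinearMap.range B') < Module.finrank ℂ (LinearMap.range B'')) :
    ∃ B ∈ 𝔊, Θ * B = B ∧ B * Θ = -B ∧ ∀ p ∈ P, ∃ w, B w = p := by
  classical
  have hraiseval : ∀ Z : Module.End ℂ W, Θ * Z = Z → ∀ w, Z w ∈ P := fun Z hΘZ w =>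
    (hP _).2 (by rw [← Module.End.mul_apply, hΘZ])
  have hle : ∀ B' : Module.End ℂ W, Θ * B' = B' → Module.finrank ℂ (LinearMap.range B') ≤ a := fun B' h => by
    rw [← hPa]
    exact Submodule.finrank_mono (by rintro _ ⟨w, rfl⟩; exact hraiseval B' h w)
  have honto : ∀ B' : Module.End ℂ W, Θ * B' = B' → a ≤ Module.finrank ℂ (LinearMap.range B') →
      ∀ p ∈ P, ∃ w, B' w = p := by
    intro B' hΘB' hge p hp
    have hle' : LinearMap.range B' ≤ P := by rintro _ ⟨w, rfl⟩; exact hraiseval B' hΘB' w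
    have heq : LinearMap.range B' = P := Submodule.eq_of_le_of_finrank_le hle' (by rw [hPa]; exact hge)
    have hp' : p ∈ LinearMap.range B' := heq ▸ hp
    exact hp'
  have key : ∀ k : ℕ, ∃ B ∈ 𝔊, Θ * B = B ∧ B * Θ = -B ∧ min (k + 2) a ≤ Module.finrank ℂ (LinearMap.range B) := by
    intro k
    induction k with
    | zero =>
      obtain ⟨B, hB, h1, h2, h3⟩ :=
        UnitaryThreeCoprime.exists_raise_rank_ge_two hbr hirr hΘ hΘΘ hP hQ (by omega) hQ2
      exact ⟨B, hB, h1, h2, by omega⟩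
    | succ k ih =>
      obtain ⟨B, hB, h1, h2, h3⟩ := ih
      by_cases hk : a ≤ Module.finrank ℂ (LinearMap.range B)
      · exact ⟨B, hB, h1, h2, by omega⟩
      · obtain ⟨B', hB', h1', h2', hlt⟩ := hup B hB h1 h2 (by omega) (by omega)
        exact ⟨B', hB', h1', h2', by omega⟩
  obtain ⟨B, hB, h1, h2, h3⟩ := key (a - 2)
  exact ⟨B, hB, h1, h2, honto B h1 (by omega)⟩

end Ladder

/-! ### §1 Multiplicities `(9, b)` -/

section Nine

universe u

variable {W : Type u} [AddCommGroup W] [Module ℂ W]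

/-- **The rank-nine raising lemma** (`dim P = 9`, `dim Q ≥ 10` odd and prime to `3`; `s` `ℂ`-homogeneous in the first
slot): ranks `2, 4, 5, 7 → +1` by the Ψ-core route with the cores `(7|2)`, `(5|4)`, `(4|5)`, `(2|7)`; ranks `3, 6 → +1`
by the Φ-route with the cores `(3 | b − 3)`, `(6 | b − 6)`; rank `8 → 9` by the triple route.
[cite: Ribet1983, Thm. 3] [cite: Gordon1997, Thm. 6.3 (3)] [cite: Deligne1982HodgeCycles, I §3 Prop. 3.6] -/
theorem UnitaryNine.exists_raise_onto_nine_of_smul [FiniteDimensional ℂ W] {𝔊 : Submodule ℂ (Module.End ℂ W)}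
    (hbr : ∀ Y ∈ 𝔊, ∀ Z ∈ 𝔊, Y * Z - Z * Y ∈ 𝔊)
    (hirr : ∀ U : Submodule ℂ W, (∀ A ∈ 𝔊, ∀ u ∈ U, A u ∈ U) → U = ⊥ ∨ U = ⊤)
    {Θ : Module.End ℂ W} (hΘ : Θ ∈ 𝔊) (hΘΘ : Θ * Θ = 1)
    {P Q : Submodule ℂ W} (hP : ∀ x, x ∈ P ↔ Θ x = x) (hQ : ∀ x, x ∈ Q ↔ Θ x = -x)
    (hP9 : Module.finrank ℂ P = 9) (hQ10 : 10 ≤ Module.finrank ℂ Q) (hQodd : Odd (Module.finrank ℂ Q))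
    (hQ3 : ¬ 3 ∣ Module.finrank ℂ Q)
    {s : W → W → ℂ} (hadd : ∀ x y z, s (x + y) z = s x z + s y z)
    (hsmul : ∀ (c : ℂ) (x y : W), s (c • x) y = c * s x y) (hsymm : ∀ x y, s y x = starRingEnd ℂ (s x y))
    (hPQ : ∀ p ∈ P, ∀ q ∈ Q, s p q = 0) (hdefP : ∀ p ∈ P, s p p = 0 → p = 0) (hdefQ : ∀ q ∈ Q, s q q = 0 → q = 0)
    (hadj : ∀ X ∈ 𝔊, ∃ Y ∈ 𝔊, ∀ x y, s (X x) y = s x (Y y)) :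
    ∃ B ∈ 𝔊, Θ * B = B ∧ B * Θ = -B ∧ ∀ p ∈ P, ∃ w, B w = p := by
  classical
  obtain ⟨k, hk⟩ := hQodd
  refine UnitaryLadder.exists_raise_onto_of_hup hbr hirr hΘ hΘΘ hP hQ hP9 (by norm_num) (by omega) ?_
  intro B' hB' hΘB' hB'Θ h2 h8
  by_cases hr8 : Module.finrank ℂ (LinearMap.range B') = 8
  · -- triple route: `m (9 − ρ) = 8 ρ` forces `3 ∣ dim Q`
    refine UnitaryRaisingRank.exists_raise_rank_gt_of_finrank_eq_succ_of_smul hbr hirr hΘ hΘΘ hP hQ hB' hΘB' hB'Θ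
      (by omega) (by rw [hr8, hP9]) (by omega) (fun ρ hρ1 hρr => ?_) hadd hsmul hsymm hPQ hdefP hdefQ hadj
    rw [hr8] at hρr ⊢
    interval_cases ρ <;> omega
  by_cases hr36 : Module.finrank ℂ (LinearMap.range B') = 3 ∨ Module.finrank ℂ (LinearMap.range B') = 6
  · -- Φ-route with the cores `(3 | b − 3)`, `(6 | b − 6)`
    refine UnitaryRaisingRank.exists_raise_rank_gt_of_two_le hbr hirr hΘ hΘΘ hP hQ hadd hsymm hPQ hdefP hdefQ
      hadj hB' hΘB' hB'Θ (by omega) (by omega) (by omega) fun U 𝔩 ι P' Q' hbr𝔩 hirr𝔩 hι hιι hP' hQ' hfinP' hfinQ'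
        hP'Q' hdefP' hdefQ' hadj𝔩 => ?_
    rcases hr36 with hr3 | hr6
    · exact UnitaryThreeCoprime.eq_top hbr𝔩 hirr𝔩 hι hιι hP' hQ' (by rw [hfinP', hr3]) (by omega)
        (s := fun x y : U => s (x : W) y) (fun x y z => by simp only [Submodule.coe_add, hadd])
        (fun x y => hsymm x y) hP'Q' hdefP' hdefQ' hadj𝔩
    · exact UnitarySix.eq_top_of_smul hbr𝔩 hirr𝔩 hι hιι hP' hQ' (by rw [hfinP', hr6]) ⟨k - 3, by omega⟩ (by omega)
        (s := fun x y : U => s (x : W) y) (fun x y z => by simp only [Submodule.coe_add, hadd])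
        (fun c x y => by simp only [Submodule.coe_smul, hsmul]) (fun x y => hsymm x y) hP'Q' hdefP' hdefQ' hadj𝔩
  · -- Ψ-core route with the cores `(7|2)`, `(5|4)`, `(4|5)`, `(2|7)`
    push Not at hr36
    refine UnitaryRaisingRank.exists_raise_rank_gt_of_psi_core hbr hirr hΘ hΘΘ hP hQ hB' hΘB' hB'Θ (by omega)
      (by omega) (by omega) hadd hsymm hPQ hdefP hdefQ hadj fun U 𝔩 ι P' Q' hbr𝔩 hirr𝔩 hι hιι hP' hQ' hfinP' hfinQ'
        hP'Q' hdefP' hdefQ' hadj𝔩 => ?_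
    by_cases hr2 : Module.finrank ℂ (LinearMap.range B') = 2
    · exact UnitaryTwoOdd.eq_top' hbr𝔩 hirr𝔩 hι hιι hP' hQ' ⟨3, by omega⟩ (by rw [hfinQ', hr2])
        (s := fun x y : U => s (x : W) y) (fun x y z => by simp only [Submodule.coe_add, hadd])
        (fun x y => hsymm x y) hP'Q' hdefP' hdefQ' hadj𝔩
    by_cases hr4 : Module.finrank ℂ (LinearMap.range B') = 4
    · exact UnitaryFourOdd.eq_top' hbr𝔩 hirr𝔩 hι hιι hP' hQ' ⟨2, by omega⟩ (by rw [hfinQ', hr4])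
        (s := fun x y : U => s (x : W) y) (fun x y z => by simp only [Submodule.coe_add, hadd])
        (fun x y => hsymm x y) hP'Q' hdefP' hdefQ' hadj𝔩
    by_cases hr5 : Module.finrank ℂ (LinearMap.range B') = 5
    · exact UnitaryFourOdd.eq_top hbr𝔩 hirr𝔩 hι hιι hP' hQ' (by omega) (by rw [hfinQ', hr5]; exact ⟨2, rfl⟩)
        (s := fun x y : U => s (x : W) y) (fun x y z => by simp only [Submodule.coe_add, hadd])
        (fun x y => hsymm x y) hP'Q' hdefP' hdefQ' hadj𝔩
    · have hr7 : Module.finrank ℂ (LinearMap.range B') = 7 := by omega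
      exact UnitaryTwoOdd.eq_top hbr𝔩 hirr𝔩 hι hιι hP' hQ' (by omega) (by rw [hfinQ', hr7]; exact ⟨3, rfl⟩)
        (s := fun x y : U => s (x : W) y) (fun x y z => by simp only [Submodule.coe_add, hadd])
        (fun x y => hsymm x y) hP'Q' hdefP' hdefQ' hadj𝔩

/-- **THE `Θ`-SUBALGEBRA THEOREM FOR UNITARY MULTIPLICITIES `(9, b)`, `b ∈ {1, 2, 4, 5, 7, 11, 13}`** (i.e. `b ≤ 13`,
`3 ∤ b`, `b ∉ {8, 10}`; Ribet's Thm. 3 at `(9, n″)`, classification-free; NEW: `(9, 11)`, `(9, 13)`). Bases by the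
mirrored cores `(1|·)`, `(2|odd)`, `(4|odd)`, `(5|·)`, `(7|·)`; `b = 11, 13` by one Euclid step onto `(9|2)`, `(9|4)`.
[cite: Ribet1983, Thm. 3] [cite: Gordon1997, Thm. 6.3 (3) and pp. 18–19] [cite: Deligne1982HodgeCycles, I §3 Prop. 3.4, 3.6] -/
theorem UnitaryNine.eq_top_of_smul [FiniteDimensional ℂ W] {𝔊 : Submodule ℂ (Module.End ℂ W)}
    (hbr : ∀ Y ∈ 𝔊, ∀ Z ∈ 𝔊, Y * Z - Z * Y ∈ 𝔊)
    (hirr : ∀ U : Submodule ℂ W, (∀ A ∈ 𝔊, ∀ u ∈ U, A u ∈ U) → U = ⊥ ∨ U = ⊤)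
    {Θ : Module.End ℂ W} (hΘ : Θ ∈ 𝔊) (hΘΘ : Θ * Θ = 1)
    {P Q : Submodule ℂ W} (hP : ∀ x, x ∈ P ↔ Θ x = x) (hQ : ∀ x, x ∈ Q ↔ Θ x = -x)
    (hP9 : Module.finrank ℂ P = 9) (hQ13 : Module.finrank ℂ Q ≤ 13) (hQ3 : ¬ 3 ∣ Module.finrank ℂ Q)
    (hQ8 : Module.finrank ℂ Q ≠ 8) (hQ10 : Module.finrank ℂ Q ≠ 10)
    {s : W → W → ℂ} (hadd : ∀ x y z, s (x + y) z = s x z + s y z)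
    (hsmul : ∀ (c : ℂ) (x y : W), s (c • x) y = c * s x y) (hsymm : ∀ x y, s y x = starRingEnd ℂ (s x y))
    (hPQ : ∀ p ∈ P, ∀ q ∈ Q, s p q = 0) (hdefP : ∀ p ∈ P, s p p = 0 → p = 0) (hdefQ : ∀ q ∈ Q, s q q = 0 → q = 0)
    (hadj : ∀ X ∈ 𝔊, ∃ Y ∈ 𝔊, ∀ x y, s (X x) y = s x (Y y)) : 𝔊 = ⊤ := by
  by_cases hb1 : Module.finrank ℂ Q = 1
  · exact UnitaryThreeCoprime.eq_top_of_finrank_eq_one hbr hirr hΘ hΘΘ hP hQ (by omega) hb1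
  by_cases hb2 : Module.finrank ℂ Q = 2
  · exact UnitaryTwoOdd.eq_top' hbr hirr hΘ hΘΘ hP hQ (by rw [hP9]; exact ⟨4, rfl⟩) hb2 hadd hsymm hPQ hdefP hdefQ
      hadj
  by_cases hb4 : Module.finrank ℂ Q = 4
  · exact UnitaryFourOdd.eq_top' hbr hirr hΘ hΘΘ hP hQ (by rw [hP9]; exact ⟨4, rfl⟩) hb4 hadd hsymm hPQ hdefP hdefQ
      hadj
  by_cases hb5 : Module.finrank ℂ Q = 5
  · exact UnitaryFive.eq_top_of_smul' hbr hirr hΘ hΘΘ hP hQ (by rw [hP9]; decide) hb5 hadd hsmul hsymm hPQ hdefP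
      hdefQ hadj
  by_cases hb7 : Module.finrank ℂ Q = 7
  · exact UnitarySeven.eq_top_of_smul' hbr hirr hΘ hΘΘ hP hQ (by rw [hP9]; decide) hb7 hadd hsmul hsymm hPQ hdefP
      hdefQ hadj
  by_cases hb11 : Module.finrank ℂ Q = 11
  · -- one Euclid step onto `(9 | 2)`
    refine UnitaryCoprimeStep.eq_top_of_onto_of_core hbr hirr hΘ hΘΘ hP hQ hP9 hb11 (by norm_num) (by norm_num) hadd
      hsymm hPQ hdefP hdefQ hadj ?_ ?_
    · exact UnitaryNine.exists_raise_onto_nine_of_smul hbr hirr hΘ hΘΘ hP hQ hP9 (by omega) ⟨5, by omega⟩ (by omega)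
        hadd hsmul hsymm hPQ hdefP hdefQ hadj
    · intro 𝔩 ι P' Q' hbr𝔩 hirr𝔩 hι hιι hP' hQ' hfinP' hfinQ' hP'Q' hdefP' hdefQ' hadj𝔩
      exact UnitaryTwoOdd.eq_top' hbr𝔩 hirr𝔩 hι hιι hP' hQ' ⟨4, by omega⟩ (by omega)
        (s := fun x y : Q => s (x : W) y) (fun x y z => by simp only [Submodule.coe_add, hadd])
        (fun x y => hsymm x y) hP'Q' hdefP' hdefQ' hadj𝔩
  have hb13 : Module.finrank ℂ Q = 13 := by omega
  -- one Euclid step onto `(9 | 4)`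
  refine UnitaryCoprimeStep.eq_top_of_onto_of_core hbr hirr hΘ hΘΘ hP hQ hP9 hb13 (by norm_num) (by norm_num) hadd
    hsymm hPQ hdefP hdefQ hadj ?_ ?_
  · exact UnitaryNine.exists_raise_onto_nine_of_smul hbr hirr hΘ hΘΘ hP hQ hP9 (by omega) ⟨6, by omega⟩ (by omega)
      hadd hsmul hsymm hPQ hdefP hdefQ hadj
  · intro 𝔩 ι P' Q' hbr𝔩 hirr𝔩 hι hιι hP' hQ' hfinP' hfinQ' hP'Q' hdefP' hdefQ' hadj𝔩
    exact UnitaryFourOdd.eq_top' hbr𝔩 hirr𝔩 hι hιι hP' hQ' ⟨4, by omega⟩ (by omega)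
      (s := fun x y : Q => s (x : W) y) (fun x y z => by simp only [Submodule.coe_add, hadd])
      (fun x y => hsymm x y) hP'Q' hdefP' hdefQ' hadj𝔩

/-- **The mirror `(b | 9)`, `b ∈ {1, 2, 4, 5, 7, 11, 13}`** (apply `eq_top_of_smul` to `−Θ`). [cite: Ribet1983, Thm. 3]
[cite: Gordon1997, Thm. 6.3 (3)] -/
theorem UnitaryNine.eq_top_of_smul' [FiniteDimensional ℂ W] {𝔊 : Submodule ℂ (Module.End ℂ W)}
    (hbr : ∀ Y ∈ 𝔊, ∀ Z ∈ 𝔊, Y * Z - Z * Y ∈ 𝔊)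
    (hirr : ∀ U : Submodule ℂ W, (∀ A ∈ 𝔊, ∀ u ∈ U, A u ∈ U) → U = ⊥ ∨ U = ⊤)
    {Θ : Module.End ℂ W} (hΘ : Θ ∈ 𝔊) (hΘΘ : Θ * Θ = 1)
    {P Q : Submodule ℂ W} (hP : ∀ x, x ∈ P ↔ Θ x = x) (hQ : ∀ x, x ∈ Q ↔ Θ x = -x)
    (hP13 : Module.finrank ℂ P ≤ 13) (hP3 : ¬ 3 ∣ Module.finrank ℂ P) (hP8 : Module.finrank ℂ P ≠ 8)
    (hP10 : Module.finrank ℂ P ≠ 10) (hQ9 : Module.finrank ℂ Q = 9)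
    {s : W → W → ℂ} (hadd : ∀ x y z, s (x + y) z = s x z + s y z)
    (hsmul : ∀ (c : ℂ) (x y : W), s (c • x) y = c * s x y) (hsymm : ∀ x y, s y x = starRingEnd ℂ (s x y))
    (hPQ : ∀ p ∈ P, ∀ q ∈ Q, s p q = 0) (hdefP : ∀ p ∈ P, s p p = 0 → p = 0) (hdefQ : ∀ q ∈ Q, s q q = 0 → q = 0)
    (hadj : ∀ X ∈ 𝔊, ∃ Y ∈ 𝔊, ∀ x y, s (X x) y = s x (Y y)) : 𝔊 = ⊤ := by
  have hnΘ : -Θ ∈ 𝔊 := Submodule.neg_mem _ hΘ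
  have hnΘΘ : (-Θ) * (-Θ) = 1 := by rw [neg_mul_neg, hΘΘ]
  exact UnitaryNine.eq_top_of_smul hbr hirr hnΘ hnΘΘ (P := Q) (Q := P)
    (fun x => by rw [hQ, LinearMap.neg_apply, neg_eq_iff_eq_neg]) (fun x => by rw [hP, LinearMap.neg_apply, neg_inj])
    hQ9 hP13 hP3 hP8 hP10 hadd hsmul hsymm (fun q hq p hp => by rw [hsymm, hPQ p hp q hq, map_zero]) hdefQ hdefP hadj

end Nine

/-! ### §2 Multiplicities `(11, b)`, `11 ∤ b` — ALL of them -/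

section Eleven

universe u

variable {W : Type u} [AddCommGroup W] [Module ℂ W]

/-- **The rank-eleven raising lemma, every `dim Q ≥ 12` prime to `11`** (`dim P = 11`; `s` `ℂ`-homogeneous in the first
slot): ranks `2, …, 9 → +1` by the Ψ-core route with the cores `(9|2), (8|3), (7|4), (6|5), (5|6), (4|7), (3|8), (2|9)`
(pairs summing to the prime `11`), rank `10 → 11` by the triple route (`m (11 − ρ) = 10 ρ` forces `11 ∣ dim Q`).
[cite: Ribet1983, Thm. 3] [cite: Gordon1997, Thm. 6.3 (3)] [cite: Deligne1982HodgeCycles, I §3 Prop. 3.6] -/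
theorem UnitaryEleven.exists_raise_onto_eleven_of_smul [FiniteDimensional ℂ W] {𝔊 : Submodule ℂ (Module.End ℂ W)}
    (hbr : ∀ Y ∈ 𝔊, ∀ Z ∈ 𝔊, Y * Z - Z * Y ∈ 𝔊)
    (hirr : ∀ U : Submodule ℂ W, (∀ A ∈ 𝔊, ∀ u ∈ U, A u ∈ U) → U = ⊥ ∨ U = ⊤)
    {Θ : Module.End ℂ W} (hΘ : Θ ∈ 𝔊) (hΘΘ : Θ * Θ = 1)
    {P Q : Submodule ℂ W} (hP : ∀ x, x ∈ P ↔ Θ x = x) (hQ : ∀ x, x ∈ Q ↔ Θ x = -x)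
    (hP11 : Module.finrank ℂ P = 11) (hQ12 : 12 ≤ Module.finrank ℂ Q) (hQ11 : ¬ 11 ∣ Module.finrank ℂ Q)
    {s : W → W → ℂ} (hadd : ∀ x y z, s (x + y) z = s x z + s y z)
    (hsmul : ∀ (c : ℂ) (x y : W), s (c • x) y = c * s x y) (hsymm : ∀ x y, s y x = starRingEnd ℂ (s x y))
    (hPQ : ∀ p ∈ P, ∀ q ∈ Q, s p q = 0) (hdefP : ∀ p ∈ P, s p p = 0 → p = 0) (hdefQ : ∀ q ∈ Q, s q q = 0 → q = 0)
    (hadj : ∀ X ∈ 𝔊, ∃ Y ∈ 𝔊, ∀ x y, s (X x) y = s x (Y y)) :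
    ∃ B ∈ 𝔊, Θ * B = B ∧ B * Θ = -B ∧ ∀ p ∈ P, ∃ w, B w = p := by
  classical
  refine UnitaryLadder.exists_raise_onto_of_hup hbr hirr hΘ hΘΘ hP hQ hP11 (by norm_num) (by omega) ?_
  intro B' hB' hΘB' hB'Θ h2 h10
  by_cases hr10 : Module.finrank ℂ (LinearMap.range B') = 10
  · -- triple route: `m (11 − ρ) = 10 ρ` forces `dim Q ∈ {11, 22, 55}`
    refine UnitaryRaisingRank.exists_raise_rank_gt_of_finrank_eq_succ_of_smul hbr hirr hΘ hΘΘ hP hQ hB' hΘB' hB'Θ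
      (by omega) (by rw [hr10, hP11]) (by omega) (fun ρ hρ1 hρr => ?_) hadd hsmul hsymm hPQ hdefP hdefQ hadj
    rw [hr10] at hρr ⊢
    interval_cases ρ <;> omega
  · -- Ψ-core route with the cores `(11 − r | r)`, `r = 2, …, 9`
    refine UnitaryRaisingRank.exists_raise_rank_gt_of_psi_core hbr hirr hΘ hΘΘ hP hQ hB' hΘB' hB'Θ (by omega)
      (by omega) (by omega) hadd hsymm hPQ hdefP hdefQ hadj fun U 𝔩 ι P' Q' hbr𝔩 hirr𝔩 hι hιι hP' hQ' hfinP' hfinQ'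
        hP'Q' hdefP' hdefQ' hadj𝔩 => ?_
    by_cases hr2 : Module.finrank ℂ (LinearMap.range B') = 2
    · exact UnitaryTwoOdd.eq_top' hbr𝔩 hirr𝔩 hι hιι hP' hQ' ⟨4, by omega⟩ (by rw [hfinQ', hr2])
        (s := fun x y : U => s (x : W) y) (fun x y z => by simp only [Submodule.coe_add, hadd])
        (fun x y => hsymm x y) hP'Q' hdefP' hdefQ' hadj𝔩
    by_cases hr3 : Module.finrank ℂ (LinearMap.range B') = 3
    · exact UnitaryThreeCoprime.eq_top' hbr𝔩 hirr𝔩 hι hιι hP' hQ' (by omega) (by rw [hfinQ', hr3])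
        (s := fun x y : U => s (x : W) y) (fun x y z => by simp only [Submodule.coe_add, hadd])
        (fun x y => hsymm x y) hP'Q' hdefP' hdefQ' hadj𝔩
    by_cases hr4 : Module.finrank ℂ (LinearMap.range B') = 4
    · exact UnitaryFourOdd.eq_top' hbr𝔩 hirr𝔩 hι hιι hP' hQ' ⟨3, by omega⟩ (by rw [hfinQ', hr4])
        (s := fun x y : U => s (x : W) y) (fun x y z => by simp only [Submodule.coe_add, hadd])
        (fun x y => hsymm x y) hP'Q' hdefP' hdefQ' hadj𝔩
    by_cases hr5 : Module.finrank ℂ (LinearMap.range B') = 5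
    · exact UnitaryFive.eq_top_of_smul' hbr𝔩 hirr𝔩 hι hιι hP' hQ' (by omega) (by rw [hfinQ', hr5])
        (s := fun x y : U => s (x : W) y) (fun x y z => by simp only [Submodule.coe_add, hadd])
        (fun c x y => by simp only [Submodule.coe_smul, hsmul]) (fun x y => hsymm x y) hP'Q' hdefP' hdefQ' hadj𝔩
    by_cases hr6 : Module.finrank ℂ (LinearMap.range B') = 6
    · exact UnitaryFive.eq_top_of_smul hbr𝔩 hirr𝔩 hι hιι hP' hQ' (by omega) (by rw [hfinQ', hr6]; omega)
        (s := fun x y : U => s (x : W) y) (fun x y z => by simp only [Submodule.coe_add, hadd])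
        (fun c x y => by simp only [Submodule.coe_smul, hsmul]) (fun x y => hsymm x y) hP'Q' hdefP' hdefQ' hadj𝔩
    by_cases hr7 : Module.finrank ℂ (LinearMap.range B') = 7
    · exact UnitaryFourOdd.eq_top hbr𝔩 hirr𝔩 hι hιι hP' hQ' (by omega) (by rw [hfinQ', hr7]; exact ⟨3, rfl⟩)
        (s := fun x y : U => s (x : W) y) (fun x y z => by simp only [Submodule.coe_add, hadd])
        (fun x y => hsymm x y) hP'Q' hdefP' hdefQ' hadj𝔩
    by_cases hr8 : Module.finrank ℂ (LinearMap.range B') = 8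
    · exact UnitaryThreeCoprime.eq_top hbr𝔩 hirr𝔩 hι hιι hP' hQ' (by omega) (by rw [hfinQ', hr8]; omega)
        (s := fun x y : U => s (x : W) y) (fun x y z => by simp only [Submodule.coe_add, hadd])
        (fun x y => hsymm x y) hP'Q' hdefP' hdefQ' hadj𝔩
    · have hr9 : Module.finrank ℂ (LinearMap.range B') = 9 := by omega
      exact UnitaryTwoOdd.eq_top hbr𝔩 hirr𝔩 hι hιι hP' hQ' (by omega) (by rw [hfinQ', hr9]; exact ⟨4, rfl⟩)
        (s := fun x y : U => s (x : W) y) (fun x y z => by simp only [Submodule.coe_add, hadd])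
        (fun x y => hsymm x y) hP'Q' hdefP' hdefQ' hadj𝔩

end Eleven

section MainEleven

variable {W : Type*} [AddCommGroup W] [Module ℂ W]

universe u in
/-- The induction behind `UnitaryEleven.eq_top_of_smul` (strong induction on `b` with `11 ∤ b`; bases `b = 1, …, 10` by
the mirrored cores `(1|·), (2|odd), (3|·), (4|odd), (5|·), (6|·), (7|·), (8|·), (9|·), (10|·)` at `dim P = 11`; step
`b → b − 11` by `UnitaryCoprimeStep.eq_top_of_onto_of_core`). [cite: Ribet1983, Thm. 3]
[cite: Gordon1997, §6 (proof of Thm. 6.3.3, pp. 18–19)] -/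
private theorem UnitaryEleven.eq_top_of_smul_aux (b : ℕ) :
    ∀ {W : Type u} [AddCommGroup W] [Module ℂ W] [FiniteDimensional ℂ W]
      {𝔊 : Submodule ℂ (Module.End ℂ W)},
      (∀ Y ∈ 𝔊, ∀ Z ∈ 𝔊, Y * Z - Z * Y ∈ 𝔊) →
      (∀ U : Submodule ℂ W, (∀ A ∈ 𝔊, ∀ u ∈ U, A u ∈ U) → U = ⊥ ∨ U = ⊤) →
      ∀ {Θ : Module.End ℂ W}, Θ ∈ 𝔊 → Θ * Θ = 1 →
      ∀ {P Q : Submodule ℂ W}, (∀ x, x ∈ P ↔ Θ x = x) → (∀ x, x ∈ Q ↔ Θ x = -x) →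
      Module.finrank ℂ P = 11 → Module.finrank ℂ Q = b → ¬ 11 ∣ b →
      ∀ {s : W → W → ℂ}, (∀ x y z, s (x + y) z = s x z + s y z) →
      (∀ (c : ℂ) (x y : W), s (c • x) y = c * s x y) →
      (∀ x y, s y x = starRingEnd ℂ (s x y)) →
      (∀ p ∈ P, ∀ q ∈ Q, s p q = 0) → (∀ p ∈ P, s p p = 0 → p = 0) → (∀ q ∈ Q, s q q = 0 → q = 0) →
      (∀ X ∈ 𝔊, ∃ Y ∈ 𝔊, ∀ x y, s (X x) y = s x (Y y)) → 𝔊 = ⊤ := by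
  induction b using Nat.strong_induction_on with
  | _ b ih =>
  intro W _ _ _ 𝔊 hbr hirr Θ hΘ hΘΘ P Q hP hQ hP11 hQb hb11 s hadd hsmul hsymm hPQ hdefP hdefQ hadj
  have hb0 : b ≠ 0 := fun h => hb11 (by rw [h]; exact dvd_zero 11)
  by_cases hb1 : b = 1
  · exact UnitaryThreeCoprime.eq_top_of_finrank_eq_one hbr hirr hΘ hΘΘ hP hQ (by omega) (by rw [hQb, hb1])
  by_cases hb2 : b = 2
  · exact UnitaryTwoOdd.eq_top' hbr hirr hΘ hΘΘ hP hQ (by rw [hP11]; exact ⟨5, rfl⟩) (by rw [hQb, hb2]) hadd hsymm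
      hPQ hdefP hdefQ hadj
  by_cases hb3 : b = 3
  · exact UnitaryThreeCoprime.eq_top' hbr hirr hΘ hΘΘ hP hQ (by rw [hP11]; decide) (by rw [hQb, hb3]) hadd hsymm hPQ
      hdefP hdefQ hadj
  by_cases hb4 : b = 4
  · exact UnitaryFourOdd.eq_top' hbr hirr hΘ hΘΘ hP hQ (by rw [hP11]; exact ⟨5, rfl⟩) (by rw [hQb, hb4]) hadd hsymm
      hPQ hdefP hdefQ hadj
  by_cases hb5 : b = 5
  · exact UnitaryFive.eq_top_of_smul' hbr hirr hΘ hΘΘ hP hQ (by rw [hP11]; decide) (by rw [hQb, hb5]) hadd hsmul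
      hsymm hPQ hdefP hdefQ hadj
  by_cases hb6 : b = 6
  · exact UnitarySix.eq_top_of_smul' hbr hirr hΘ hΘΘ hP hQ (by rw [hP11]; exact ⟨5, rfl⟩) (by rw [hP11]; decide)
      (by rw [hQb, hb6]) hadd hsmul hsymm hPQ hdefP hdefQ hadj
  by_cases hb7 : b = 7
  · exact UnitarySeven.eq_top_of_smul' hbr hirr hΘ hΘΘ hP hQ (by rw [hP11]; decide) (by rw [hQb, hb7]) hadd hsmul
      hsymm hPQ hdefP hdefQ hadj
  by_cases hb8 : b = 8
  · exact UnitaryEight.eq_top_of_smul' hbr hirr hΘ hΘΘ hP hQ (by rw [hP11]; exact ⟨5, rfl⟩) (by omega) (by omega)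
      (by rw [hQb, hb8]) hadd hsmul hsymm hPQ hdefP hdefQ hadj
  by_cases hb9 : b = 9
  · exact UnitaryNine.eq_top_of_smul' hbr hirr hΘ hΘΘ hP hQ (by omega) (by rw [hP11]; decide) (by omega) (by omega)
      (by rw [hQb, hb9]) hadd hsmul hsymm hPQ hdefP hdefQ hadj
  by_cases hb10 : b = 10
  · exact UnitaryTen.eq_top_of_smul' hbr hirr hΘ hΘΘ hP hQ (by rw [hP11]; exact ⟨5, rfl⟩) (by rw [hP11]; decide)
      (by omega) (by omega) (by rw [hQb, hb10]) hadd hsmul hsymm hPQ hdefP hdefQ hadj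
  have hb12 : 12 ≤ b := by omega
  refine UnitaryCoprimeStep.eq_top_of_onto_of_core hbr hirr hΘ hΘΘ hP hQ hP11 hQb (by norm_num) (by omega) hadd hsymm
    hPQ hdefP hdefQ hadj ?_ ?_
  · exact UnitaryEleven.exists_raise_onto_eleven_of_smul hbr hirr hΘ hΘΘ hP hQ hP11 (by rw [hQb]; exact hb12)
      (by rw [hQb]; exact hb11) hadd hsmul hsymm hPQ hdefP hdefQ hadj
  · intro 𝔩 ι P' Q' hbr𝔩 hirr𝔩 hι hιι hP' hQ' hfinP' hfinQ' hP'Q' hdefP' hdefQ' hadj𝔩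
    exact ih (b - 11) (by omega) hbr𝔩 hirr𝔩 hι hιι hP' hQ' hfinP' hfinQ' (fun h => hb11 (by omega))
      (s := fun x y : Q => s (x : W) y) (fun x y z => by simp only [Submodule.coe_add, hadd])
      (fun c x y => by simp only [Submodule.coe_smul, hsmul]) (fun x y => hsymm x y) hP'Q' hdefP' hdefQ' hadj𝔩

/-- **THE `Θ`-SUBALGEBRA THEOREM FOR UNITARY MULTIPLICITIES `(11, b)`, EVERY `b` PRIME TO `11`** (Ribet's Thm. 3 at
`(11, n″)`, `11 ∤ n″`, classification-free; NEW beyond the tree's `(11, ≤ 10)`: `b = 12, 13, 14, …`; the `23`-fold cell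
`{11, 12}`). [cite: Ribet1983, Thm. 3] [cite: Gordon1997, Thm. 6.3 (3) and pp. 18–19] [cite: Deligne1982HodgeCycles, I §3 Prop. 3.4, 3.6] -/
theorem UnitaryEleven.eq_top_of_smul [FiniteDimensional ℂ W] {𝔊 : Submodule ℂ (Module.End ℂ W)}
    (hbr : ∀ Y ∈ 𝔊, ∀ Z ∈ 𝔊, Y * Z - Z * Y ∈ 𝔊)
    (hirr : ∀ U : Submodule ℂ W, (∀ A ∈ 𝔊, ∀ u ∈ U, A u ∈ U) → U = ⊥ ∨ U = ⊤)
    {Θ : Module.End ℂ W} (hΘ : Θ ∈ 𝔊) (hΘΘ : Θ * Θ = 1)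
    {P Q : Submodule ℂ W} (hP : ∀ x, x ∈ P ↔ Θ x = x) (hQ : ∀ x, x ∈ Q ↔ Θ x = -x)
    (hP11 : Module.finrank ℂ P = 11) (hQ11 : ¬ 11 ∣ Module.finrank ℂ Q)
    {s : W → W → ℂ} (hadd : ∀ x y z, s (x + y) z = s x z + s y z)
    (hsmul : ∀ (c : ℂ) (x y : W), s (c • x) y = c * s x y) (hsymm : ∀ x y, s y x = starRingEnd ℂ (s x y))
    (hPQ : ∀ p ∈ P, ∀ q ∈ Q, s p q = 0) (hdefP : ∀ p ∈ P, s p p = 0 → p = 0) (hdefQ : ∀ q ∈ Q, s q q = 0 → q = 0)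
    (hadj : ∀ X ∈ 𝔊, ∃ Y ∈ 𝔊, ∀ x y, s (X x) y = s x (Y y)) : 𝔊 = ⊤ :=
  UnitaryEleven.eq_top_of_smul_aux _ hbr hirr hΘ hΘΘ hP hQ hP11 rfl hQ11 hadd hsmul hsymm hPQ hdefP hdefQ hadj

/-- **The mirror `(b | 11)`, `11 ∤ b`** (apply `eq_top_of_smul` to `−Θ`). [cite: Ribet1983, Thm. 3]
[cite: Gordon1997, Thm. 6.3 (3)] -/
theorem UnitaryEleven.eq_top_of_smul' [FiniteDimensional ℂ W] {𝔊 : Submodule ℂ (Module.End ℂ W)}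
    (hbr : ∀ Y ∈ 𝔊, ∀ Z ∈ 𝔊, Y * Z - Z * Y ∈ 𝔊)
    (hirr : ∀ U : Submodule ℂ W, (∀ A ∈ 𝔊, ∀ u ∈ U, A u ∈ U) → U = ⊥ ∨ U = ⊤)
    {Θ : Module.End ℂ W} (hΘ : Θ ∈ 𝔊) (hΘΘ : Θ * Θ = 1)
    {P Q : Submodule ℂ W} (hP : ∀ x, x ∈ P ↔ Θ x = x) (hQ : ∀ x, x ∈ Q ↔ Θ x = -x)
    (hP11 : ¬ 11 ∣ Module.finrank ℂ P) (hQ11 : Module.finrank ℂ Q = 11)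
    {s : W → W → ℂ} (hadd : ∀ x y z, s (x + y) z = s x z + s y z)
    (hsmul : ∀ (c : ℂ) (x y : W), s (c • x) y = c * s x y) (hsymm : ∀ x y, s y x = starRingEnd ℂ (s x y))
    (hPQ : ∀ p ∈ P, ∀ q ∈ Q, s p q = 0) (hdefP : ∀ p ∈ P, s p p = 0 → p = 0) (hdefQ : ∀ q ∈ Q, s q q = 0 → q = 0)
    (hadj : ∀ X ∈ 𝔊, ∃ Y ∈ 𝔊, ∀ x y, s (X x) y = s x (Y y)) : 𝔊 = ⊤ := by
  have hnΘ : -Θ ∈ 𝔊 := Submodule.neg_mem _ hΘ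
  have hnΘΘ : (-Θ) * (-Θ) = 1 := by rw [neg_mul_neg, hΘΘ]
  exact UnitaryEleven.eq_top_of_smul hbr hirr hnΘ hnΘΘ (P := Q) (Q := P)
    (fun x => by rw [hQ, LinearMap.neg_apply, neg_eq_iff_eq_neg]) (fun x => by rw [hP, LinearMap.neg_apply, neg_inj])
    hQ11 hP11 hadd hsmul hsymm (fun q hq p hp => by rw [hsymm, hPQ p hp q hq, map_zero]) hdefQ hdefP hadj

end MainEleven

/-! ### §3 The top rank never obstructs for coprime `(dim P, dim Q)` -/

section TopRank

universe u

variable {W : Type u} [AddCommGroup W] [Module ℂ W]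

/-- **The top-rank raising lemma for COPRIME multiplicities.** In the setting of the unitary cores, let `B ∈ 𝔊` be
raising of rank `r ≥ 2` with `dim P = r + 1`, `r < dim Q` and `gcd(dim P, dim Q) = 1` (the Hermitian form
`ℂ`-homogeneous in the first slot). Then some raising operator of `𝔊` has rank `> r`. PROOF: the triple route
(`exists_raise_rank_gt_of_finrank_eq_succ_of_smul`) needs no solution of `m (r + 1 − ρ) = r ρ`, `1 ≤ ρ < r`,
`m = dim Q − r`; a solution gives `m (r + 1) = ρ (m + r) = ρ · dim Q`, so `r + 1 = dim P` divides `ρ · dim Q`, hence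
divides `ρ < r` — absurd. (So for coprime pairs the Euclid ladder can only stall at ranks `r ≤ dim P − 2`.)
[cite: Ribet1983, Thm. 3] [cite: Deligne1982HodgeCycles, I §3 Prop. 3.6] -/
theorem UnitaryRaisingRank.exists_raise_rank_gt_of_finrank_eq_succ_of_coprime [FiniteDimensional ℂ W]
    {𝔊 : Submodule ℂ (Module.End ℂ W)}
    (hbr : ∀ Y ∈ 𝔊, ∀ Z ∈ 𝔊, Y * Z - Z * Y ∈ 𝔊)
    (hirr : ∀ U : Submodule ℂ W, (∀ A ∈ 𝔊, ∀ u ∈ U, A u ∈ U) → U = ⊥ ∨ U = ⊤)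
    {Θ : Module.End ℂ W} (hΘ : Θ ∈ 𝔊) (hΘΘ : Θ * Θ = 1)
    {P Q : Submodule ℂ W} (hP : ∀ x, x ∈ P ↔ Θ x = x) (hQ : ∀ x, x ∈ Q ↔ Θ x = -x)
    {B : Module.End ℂ W} (hB : B ∈ 𝔊) (hΘB : Θ * B = B) (hBΘ : B * Θ = -B)
    (hr2 : 2 ≤ Module.finrank ℂ (LinearMap.range B))
    (hrP : Module.finrank ℂ P = Module.finrank ℂ (LinearMap.range B) + 1)
    (hrQ : Module.finrank ℂ (LinearMap.range B) < Module.finrank ℂ Q)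
    (hcop : Nat.Coprime (Module.finrank ℂ P) (Module.finrank ℂ Q))
    {s : W → W → ℂ} (hadd : ∀ x y z, s (x + y) z = s x z + s y z)
    (hsmul : ∀ (c : ℂ) (x y : W), s (c • x) y = c * s x y) (hsymm : ∀ x y, s y x = starRingEnd ℂ (s x y))
    (hPQ : ∀ p ∈ P, ∀ q ∈ Q, s p q = 0) (hdefP : ∀ p ∈ P, s p p = 0 → p = 0) (hdefQ : ∀ q ∈ Q, s q q = 0 → q = 0)
    (hadj : ∀ X ∈ 𝔊, ∃ Y ∈ 𝔊, ∀ x y, s (X x) y = s x (Y y)) :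
    ∃ B' ∈ 𝔊, Θ * B' = B' ∧ B' * Θ = -B' ∧
      Module.finrank ℂ (LinearMap.range B) < Module.finrank ℂ (LinearMap.range B') := by
  refine UnitaryRaisingRank.exists_raise_rank_gt_of_finrank_eq_succ_of_smul hbr hirr hΘ hΘΘ hP hQ hB hΘB hBΘ hr2 hrP
    hrQ (fun ρ hρ1 hρr heq => ?_) hadd hsmul hsymm hPQ hdefP hdefQ hadj
  set r := Module.finrank ℂ (LinearMap.range B) with hr
  obtain ⟨m, hm⟩ : ∃ m, Module.finrank ℂ Q = m + r := ⟨_, (Nat.sub_add_cancel hrQ.le).symm⟩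
  rw [hm, Nat.add_sub_cancel] at heq
  -- `heq : m * (r + 1 - ρ) = r * ρ`, hence `m (r + 1) = ρ (m + r)`
  have hρ : ρ ≤ r + 1 := by omega
  have h1 : m * (r + 1) = ρ * (m + r) := by
    zify [hρ] at heq ⊢
    linear_combination heq
  have h2 : (r + 1) ∣ ρ * (m + r) := ⟨m, by rw [← h1, mul_comm]⟩
  have hcop' : Nat.Coprime (r + 1) (m + r) := by
    rw [hrP, hm] at hcop
    exact hcop
  have h3 : (r + 1) ∣ ρ := hcop'.dvd_of_dvd_mul_right h2
  have h4 := Nat.le_of_dvd (by omega) h3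
  omega

end TopRank

end HodgeStructure

end Literature.AlgebraicGeometry.Motives

end
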